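import Summits.QuantumFields.GaugeBoot.Rows.SymB4
import Summits.QuantumFields.GaugeBoot.Rows.RedEnc
import HarnessLib

/-!
# Gauge-boot: symmetry kit `SymLoop` — kernel loops, support lists, nested-range eliminators and the compact entry check (definitions)

Cell `pub-gaugeboot` (HOME `run/shared/lean/pub/pub-gaugeboot/`), seat lean1 (torus layer for the kz-L2-rp-4D family; reusable for
every `D = 4` family).  HONEST FRAMING (page 1 of every file of this cell): certified bounds on lattice expectations at STATED coupling,
gauge group, dimension and torus size; NOT a mass gap, NOT a continuum limit, NOT a string tension, NOT large `N`.
The venture is explicitly NOT Yang–Mills-summit-bearing (barriers `FixedCouplingUltralocality`, `PerturbativeInvisibility`).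

The COMPUTATIONAL side of the symmetry-factorised torus layer, kept import-light so that the bulk data / kernel-check modules of a family
(irrep data, orbit tables, reduction identities) do not wait for the analytic kit (`SymGram`/`SymFam`/`SymAsm`):
* `sumLoop` (+ `sumLoop_eq_sum`), the support-list interface `tcF` / `irr_inj` / `irr_cover` / `irr_conv`;
* `nested_elim` / `nested_elim'`: every bulk `decide +kernel` is stated over NESTED small ranges `∀ a < A, ∀ b < B` (kernel recursion
  depth `A + B` instead of `A·B`) and converted back to a flat range;
* `cjOf` (the right factor `[(1024 j + t, c_t)]`), sorted/packed key lists, `slot` (binary search) and `entryCheck`: lean3's entry, scaled,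
  against `den·Σ_t c_t·e_{cls(t)}` with the occurring variables RELABELLED by rank (so `RedEnc.encCheck` runs on a few hundred slots instead
  of `NV = 10878` positions — the kernel's memory stays small).  Soundness is in `SymAsm`.  [folklore]
-/

noncomputable section

open Literature.MathematicalPhysics.QuantumFieldTheory
open Finset
open Summit.QuantumFields.GaugeBoot.GLYZc2D3 (SVec)

namespace Summit.QuantumFields.GaugeBoot

namespace SymB4

/-! ## Integer loops -/

/-- `Σ_{t < n} f t` by structural recursion (kernel-evaluable). -/
def sumLoop : ℕ → (ℕ → ℤ) → ℤ
  | 0, _ => 0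
  | k + 1, f => f k + sumLoop k f

/-- `sumLoop n f = Σ_{t : Fin n} f t`. -/
theorem sumLoop_eq_sum (f : ℕ → ℤ) : ∀ n : ℕ, sumLoop n f = ∑ t : Fin n, f t.val
  | 0 => by simp [sumLoop]
  | k + 1 => by rw [sumLoop, sumLoop_eq_sum f k, Fin.sum_univ_castSucc, add_comm]; simp

/-! ## Support lists of irrep coefficients -/

section Irr

variable {nT : ℕ} (tcode : ℕ → ℕ) (htc : ∀ t : Fin nT, tcode t.val < 768)

/-- The support list as a function into the codes. -/
def tcF (t : Fin nT) : Fin 768 := ⟨tcode t.val, htc t⟩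

/-- A strictly increasing support list is injective. -/
theorem irr_inj (hmono : ∀ t : Fin nT, t.val + 1 < nT → tcode t.val < tcode (t.val + 1)) : Function.Injective (tcF tcode htc) := by
  have hsm : StrictMono (fun t : Fin nT => tcode t.val) := by
    intro a b hab
    have key : ∀ d : ℕ, ∀ a : ℕ, a + d + 1 < nT → tcode a < tcode (a + d + 1) := by
      intro d
      induction d with
      | zero => intro a ha; exact hmono ⟨a, by omega⟩ (by simpa using ha)
      | succ d ih =>
        intro a ha
        have h1 := ih a (by omega)
        have h2 := hmono ⟨a + d + 1, by omega⟩ (by simp; omega)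
        have : a + (d + 1) + 1 = a + d + 1 + 1 := by omega
        rw [this]; exact h1.trans h2
    have hlt : a.val < b.val := hab
    obtain ⟨d, hd⟩ : ∃ d, b.val = a.val + d + 1 := ⟨b.val - a.val - 1, by omega⟩
    have := key d a.val (by omega)
    simpa [hd] using this
  intro a b h
  have hv : tcode a.val = tcode b.val := by simpa [tcF] using congrArg Fin.val h
  exact hsm.injective hv

/-- A position table certifies that the list covers the support of `c`. -/
theorem irr_cover (c : ℕ → ℤ) (posT : ℕ → ℕ)
    (hpos : ∀ u : Fin 768, c u.val = 0 ∨ (posT u.val < nT ∧ tcode (posT u.val) = u.val)) :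
    ∀ u : Fin 768, c u.val ≠ 0 → ∃ t, tcF tcode htc t = u := by
  intro u hu
  rcases hpos u with h | ⟨hlt, heq⟩
  · exact absurd h hu
  · exact ⟨⟨posT u.val, hlt⟩, Fin.ext heq⟩

/-- The loop form of the convolution identity gives the `Finset` form. -/
theorem irr_conv (c : ℕ → ℤ) (den : ℕ)
    (hconv : ∀ w : Fin 768, sumLoop nT (fun t => c (tcode t) * c (mul (tcode t) w.val)) = den * c w.val) :
    ∀ w : Fin 768, ∑ t, c (tcF tcode htc t).val * c (mul (tcF tcode htc t).val w.val) = den * c w.val := fun w => by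
  rw [← hconv w, sumLoop_eq_sum]; rfl

end Irr

/-! ## The right factor of the radix check and its value -/

/-- The right factor for column `j`: the terms `(1024·j + t, c(tcode t))`, `t < nT`. -/
def cjOf (c : ℕ → ℤ) (tcode : ℕ → ℕ) (nT j : ℕ) : SVec := (List.range nT).map fun t => (1024 * j + t, c (tcode t))

/-- A mapped `List.range` sum is a `Finset.range` sum. -/
theorem sum_map_range (f : ℕ → ℝ) : ∀ n : ℕ, ((List.range n).map f).sum = ∑ t ∈ Finset.range n, f t
  | 0 => by simp
  | k + 1 => by rw [List.range_succ, List.map_append, List.sum_append, sum_map_range f k, Finset.sum_range_succ]; simp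

/-- The weighted sum over the right factor is the `Fin nT` sum. -/
theorem sum_cjOf (c : ℕ → ℤ) (tcode : ℕ → ℕ) (nT j : ℕ) (g : ℕ → ℝ) (a : ℕ) (cls : ℕ → ℕ → ℕ) :
    ((cjOf c tcode nT j).map fun q => (q.2 : ℝ) * g (cls a q.1)).sum = ∑ t : Fin nT, (c (tcode t.val) : ℝ) * g (cls a (1024 * j + t.val)) := by
  simp only [cjOf, List.map_map, Function.comp_def]
  rw [sum_map_range, Fin.sum_univ_eq_sum_range (fun t => (c (tcode t) : ℝ) * g (cls a (1024 * j + t)))]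

/-! ## Nested-range eliminators (shallow kernel recursion) -/

/-- From `∀ a < A, ∀ b < B, lo + B·a + b < hi → P (lo + B·a + b)` to `∀ q ∈ [lo, hi)`, provided `hi ≤ lo + A·B`. -/
theorem nested_elim {P : ℕ → Prop} {lo hi A B : ℕ} (hAB : hi ≤ lo + A * B)
    (h : ∀ a : Fin A, ∀ b : Fin B, lo + B * a.val + b.val < hi → P (lo + B * a.val + b.val)) :
    ∀ q, lo ≤ q → q < hi → P q := by
  intro q h1 h2
  have hB : 0 < B := by
    rcases Nat.eq_zero_or_pos B with hB | hB
    · subst hB; simp at hAB; omega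
    · exact hB
  have ha : (q - lo) / B < A := by
    rw [Nat.div_lt_iff_lt_mul hB]
    have : q - lo < A * B := by omega
    simpa [Nat.mul_comm] using this
  have hb : (q - lo) % B < B := Nat.mod_lt _ hB
  have e : lo + B * ((q - lo) / B) + (q - lo) % B = q := by
    have := Nat.div_add_mod (q - lo) B; omega
  have := h ⟨_, ha⟩ ⟨_, hb⟩ (by simpa [e] using h2)
  simpa [e] using this

/-- Unguarded version (the ranges tile exactly): `∀ a < A, ∀ b < B, P (lo + B·a + b)` gives `∀ q ∈ [lo, lo + A·B)`. -/
theorem nested_elim' {P : ℕ → Prop} {lo A B : ℕ} (h : ∀ a : Fin A, ∀ b : Fin B, P (lo + B * a.val + b.val)) :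
    ∀ q, lo ≤ q → q < lo + A * B → P q :=
  nested_elim (hi := lo + A * B) le_rfl fun a b _ => h a b

/-! ## Sorted key lists, packed keys, binary search -/

/-- Insert a key into a sorted list of distinct keys (no duplicate inserted). -/
def kins (v : ℕ) : List ℕ → List ℕ
  | [] => [v]
  | w :: t => if v < w then v :: w :: t else if v = w then w :: t else w :: kins v t

/-- Sorted distinct key list of a form's variables plus extra keys. -/
def keysOf (e : SVec) (extra : List ℕ) : List ℕ :=
  extra.foldr kins (e.foldr (fun p acc => kins p.1 acc) [])

/-- Pack a key list, 14 bits per key, little-endian positions. -/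
def kpack : List ℕ → ℕ
  | [] => 0
  | v :: t => v % 2 ^ 14 + 2 ^ 14 * kpack t

/-- Key at position `p` of a packed key list. -/
def keyAt (kp p : ℕ) : ℕ := kp / 2 ^ (14 * p) % 2 ^ 14

/-- Binary search (fuelled): the least position `p ∈ [lo, hi)` with `v ≤ keyAt kp p`, or `hi`. -/
def bsAux (kp v : ℕ) : ℕ → ℕ → ℕ → ℕ
  | 0, a, _ => a
  | f + 1, a, b => if a < b then
      (let mid := (a + b) / 2
       if keyAt kp mid < v then bsAux kp v f (mid + 1) b else bsAux kp v f a mid)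
    else a

/-- Slot of `v` among `K` packed keys, truncated to `< K` (so that it is always a valid slot when `K ≥ 1`). -/
def slot (kp K v : ℕ) : ℕ := min (bsAux kp v 20 0 K) (K - 1)

/-- `slot < K` for `K ≥ 1`. -/
theorem slot_lt {kp K : ℕ} (hK : 1 ≤ K) (v : ℕ) : slot kp K v < K := by
  unfold slot; omega

/-! ## The compact entry check -/

/-- **The per-entry check.**  `cj` = the right factor `[(1024 j + t, c_t)]`, `cls` = the class function of the row, `e` = lean3's entry
scaled by `s_i s_j`, `extra` = classes of the expansion absent from `e` (their coefficients cancel), `den` the left factor.  Keys are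
relabelled by `slot`; every relabelling is verified to hit its key; then `RedEnc.encCheck sb K` on the relabelled forms. -/
def entryCheck (sb : ℕ) (den : ℤ) (cj : SVec) (cls : ℕ → ℕ) (e : SVec) (extra : List ℕ) : Bool :=
  let ks := keysOf e extra
  let K := ks.length
  let kp := kpack ks
  decide (1 ≤ K) &&
  (e.all fun p => keyAt kp (slot kp K p.1) == p.1) &&
  (cj.all fun q => keyAt kp (slot kp K (cls q.1)) == cls q.1) &&
  RedEnc.encCheck sb K [(0, den)] cj (fun _ q => slot kp K (cls q)) (e.map fun p => (slot kp K p.1, p.2))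

end SymB4

end Summit.QuantumFields.GaugeBoot

end
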